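import Literature.MathematicalPhysics.QuantumFieldTheory.Balaban1983to89.B8Prop3GaugeFixedKLevelSrcGamma
import Literature.MathematicalPhysics.QuantumFieldTheory.Balaban1983to89.B8Eq142KLevelLocalGammaPrime

/-!
# `Balaban1983to89.B8Prop3GaugeFixedKLevelSrcGammaPrime` — [Balaban1985RegularSpaces] Thm 8 (1.146) p. 101 ∕ Thm 4 p. 88: `B8Prop3GaugeFixedKLevelSrcGamma`
# §3 (Theorem 4's existence induction at all levels, arbitrary gauge predicate `Lan`, sourced reset, edition γ) WITH (1.35) READ IN PRINT's ONE-END-POINT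
# CLASS (p. 77: «at least one end-point of b belongs to Ω») — the `avgClose`∕`avgClose166` letter of dag-n05-w1's P-carrier `B8LeafModelZd3P.zdGF3P` —
# via dag-n05-w2's `B8Eq142KLevelLocalGammaPrime.H42_of_inAx_γ'` (edition γ′); so the Thm-8 knit on the P-carrier (D7-3) consumes the carrier's (1.35)
# hypothesis VERBATIM, with NO one-level-up bridge and NO constant inflation

statement-level skeleton of published theorems with citation tags; proofs where landed; nothing here is a claim about the Yang–Mills mass gap

T. Bałaban, *Spaces of regular gauge field configurations on a lattice and gauge fixing conditions*, Commun. Math. Phys. **99** (1985) 75–102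
`[Balaban1985RegularSpaces]` ("B8"): Thm 4 p. 88, (1.35) p. 82, p. 77 (bond convention), (1.31) p. 82, (1.5)–(1.6) p. 77 (towers), Prop. 3 p. 87, Thm 8 (1.146)
p. 101.  PDF held: `paper:balaban1985-cmp99-regular-spaces-gauge-fixing` (journal page = PDF page + 74).

CITATION HEADER (lean-in-tree rule).  Cell `pub-ymgap` (HUMAN RULING D-0062, Track A), DAG node N05 = [B8], seat `pub-ymgap-dag-n05-d` (g10; R134 row s2).
WHY THIS FILE.  Design convergence on the cell bus 2026-08-28 00:05–00:14Z (dag-n05-w1 CONVERGENCE-ASK, dag-n05-w2 DESIGN-ANSWER, this seat's WORD): the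
P-carrier reads (1.35)∕(1.66) in print's one-end-point class («(γ)»), not in the driver's «box ⊂ Ω_{j−1}» class; dag-n05-w2's `H42_of_inAx_γ'` (p587580)
delivers (1.42) from exactly that class plus the tower law at the truncation.  `B8Prop3GaugeFixedKLevelSrcGamma` §2 (`hP3_gaugeFixed_of_b9_src_γ`) takes
the (1.42) feed `H42` as an ABSTRACT hypothesis, so the γ′ existence clause is §3 re-assembled with the γ′ feed — this file.

WHAT THIS FILE PROVES (one theorem, no `def`).
★★ `thm4_exists_all_levels_supp_src_γ'` — `B8Prop3GaugeFixedKLevelSrcGamma.thm4_exists_all_levels_supp_src_γ` with `h135` in the one-end-point class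
(`(Bʲ(z) ⊂ Ω_j ∨ Bʲ(z + e_μ) ⊂ Ω_j) → ‖Ū′U₀ʲ − Ū₀ʲ‖ ≤ α₁`) and the tower law `htw` at every truncation `m ≤ k`; (1.42) by `H42_of_inAx_γ'`; the rest
(`thm4_exists_all_levels_supp`, `hP3_gaugeFixed_of_b9_src_γ`) BY NAME.

HONEST SCOPE.  Assembly BY NAME; Prop. 5's sockets, the sourced in-edge `H59src` are HYPOTHESES; count-neutral; N05 NOT discharged; `≤` where print has `<`;
`T_η ↦ ℤᵈ`; one finite `T⁴` programme at fixed `ε` — nothing continuum ∕ ℝ⁴ ∕ OS ∕ mass-gap ∕ Clay.  No `sorry`, no `def`, no `instance`, no `notation`.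
Unit `pub-ymgap-dag-n05-d` (g10), 2026-08-28.
-/

noncomputable section

open NormedSpace

namespace Literature.MathematicalPhysics.QuantumFieldTheory.Balaban1983to89.B8Prop3GaugeFixedKLevelSrcGammaPrime

open Complex (I I_ne_zero)
open MatrixLog B7Prop1Explicit B7Prop2Explicit B7Prop1Local B7Eq92Concrete
open B7Prop2Explicit (C0 c2' unitaryUnits unitaryUnits_le_U1 avgClosed_unitaryUnits)
open B8Lemma1NonAbelian (mulCfg)
open B8Ineq132 (covDerivFwd covDeriv covDiv plaqF InAk CondAt BondTouches PlaqTouches)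
open B8Eq140Level (SideTouches)
open B8Eq119TwistedAxial (Restr129 InAx)
open B8Eq184Proof (gaugeExp cfgExp)
open B8Eq146AExpansion (iEta expCfg)
open B7Prop4GeneralLevels (logCovIter linCovIter)
open B8Eq155JBound (Jcur wsup)
open B8ScaledSupNorm (bondNorm msup weight Bdd)
open B7Prop3Flat (c3)
open B7Eq78Linearization (conjR)
open B8Thm2LogB (blockTop)
open B8Ineq130 (tlo thi)
open B8Prop3GaugeFixedKLevelSrcGamma (hP3_gaugeFixed_of_b9_src_γ)
open B8Thm4SupportLocal (thm4_exists_all_levels_supp)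
open B8Eq140Level (sideTouches_of_bondTouches)

-- `Site` alone could resolve to the torus sites of `Setup.lean`; re-export the `ℤ^d` sites of `B7Prop1Explicit`.
export B7Prop1Explicit (Site)

variable {d : ℕ}

section Composition

variable {𝔸 : Type*} [CStarAlgebra 𝔸] [Nontrivial 𝔸]

/-- ★★ **THEOREM 4's EXISTENCE INDUCTION AT ALL LEVELS, GAUGE TRANSFORMATIONS CARRIED BY Ω₀, ARBITRARY GAUGE PREDICATE `Lan`, SOURCED RESET, EDITION γ** (EDITION γ′: datum class `Λb` a PARAMETER under print's law «box ⊂ Ω_{j−1}»; (1.35) in PRINT's ONE-END-POINT class — the P-carrier's `zdGF3P.avgClose` letter, dag-n05-w1 — plus the tower law at every truncation; (1.42) by dag-n05-w2's `B8Eq142KLevelLocalGammaPrime.H42_of_inAx_γ'`; everything else = `thm4_exists_all_levels_supp_src_γ`) —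
`B8Thm4SupportLocal.thm4_exists_all_levels_supp` at `E j :=` the sides touching `Ω_j`, `S := Ω 0`, with `hP3 := hP3_gaugeFixed_of_b9_src` and the
(1.42) clause `B8Eq142KLevelLocal.H42_of_inAx` (both `Lan`-generic).  CONCLUSION: for every `m ≤ k` a unitary-valued `u` with `u = 1` off `Ω₀`,
(1.29) at `m` levels, `W = U′^{u⁻¹}` with `Lan m W` (`m ≥ 1`) and `W_b = e^{iηA_b}`, `A_b` self-adjoint, `‖A_b‖ ≤ c⋆(Lʲη)⁻¹` on the sides touching
`Ω_j`, `j ≤ m`, for ANY `c⋆ ≥ 5dLB₀(α₀ + α₁) + T_a + T_g` inside the windows.  REMAINING HYPOTHESES: Prop. 5's sockets AT `Lan` (`hP5base`,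
`hP5`), the SOURCED in-edge `H59src`, (1.33)/(1.34)/axial/(1.35)/(1.66)₀, geometry, windows.  At `Lan := IsLandau138W`, `T = 0` this is
`thm4_exists_all_levels_supp_landau138`; at `Lan := B8Eq138LandauZd.IsLandau146W … f` it is THEOREM 8's existence core ((1.146) with the
(1.62)-shape), the first brick of `B8Thm8Surviving.Thm8SurvivingAt` on the concrete carriers.
[cite: Balaban1985RegularSpaces, Thm 8 (1.146) p.101, Thm 4 p.88, (1.38) p.82, Prop. 3 p.87, Prop. 5 p.94, pp.94–95] -/
theorem thm4_exists_all_levels_supp_src_γ' (hd2 : 2 ≤ d) {η : ℝ} (hη : 0 < η) {L : ℕ} (hL : 2 ≤ L) (k : ℕ)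
    {U₀ U' : Site d → Fin d → 𝔸ˣ} (hU₀ : ∀ x κ, U₀ x κ ∈ unitaryUnits 𝔸) (hU' : ∀ x κ, U' x κ ∈ unitaryUnits 𝔸)
    {α₀ α₁ α₄ B₀ cstar a : ℝ} (hα₀ : 0 < α₀) (hα₁ : 0 < α₁) (hα₄ : 0 ≤ α₄) (hB₀ : 0 ≤ B₀)
    {Ta Tg : ℝ} (hTa : 0 ≤ Ta) (hTg : 0 ≤ Tg) (hc : 5 * d * L * B₀ * (α₀ + α₁) + (Ta + Tg) ≤ cstar)
    (hs₁ : α₄ ≤ 1 / 84) (hs₂ : L * cstar ≤ 1 / 12) (ha : a ≤ 1 / 4) (ha2 : 2 * a ≤ cstar)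
    -- [3] Prop. 4's linearisation windows ONE LEVEL LOWER (edition γ)
    (hα3 : C0 d * ((L : ℝ) ^ 2 * α₀) ≤ 1 / 3) (hα4 : 4 * ((L : ℝ) ^ 2 * α₀) ≤ c2' d L)
    (h16 : 16 * (2 * (L * cstar) + 8 * α₄) ≤ 1) (hd5 : 5 * (2 * (L * cstar) + 8 * α₄) * ((d : ℝ) - 1) ≤ 4)
    (hsmall : Real.exp (4 * (800 * ((d : ℝ) + 1) ^ 2 * ((d : ℝ) + 4)) * ((L : ℝ) ^ 2 * α₀))
      * (1 + 8 * (131072 * ((d : ℝ) + 1) ^ 2) * ((L : ℝ) * (2 * (L * cstar) + 8 * α₄))) ≤ 2)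
    (hc₃ : 2 * ((L : ℝ) * (2 * (L * cstar) + 8 * α₄)) ≤ c3 d L) (hside : 36 * d * B₀ * (2 * (L * cstar) + 8 * α₄) ≤ 1 / 2)
    (h50 : 50 * d * (2 * (L * cstar) + 8 * α₄) ≤ 1) (hsmall₁ : (d : ℝ) * L * α₁ ≤ 1 / 8)
    (h16γ : 16 * ((L : ℝ) * (2 * (L * cstar) + 8 * α₄)) ≤ 1)
    {C₂ : ℝ} (hC₂ : 8 * (131072 * ((d : ℝ) + 1) ^ 2) * Real.exp (4 * (800 * ((d : ℝ) + 1) ^ 2 * ((d : ℝ) + 4)) * ((L : ℝ) ^ 2 * α₀)) * (L : ℝ) ^ 2 ≤ C₂)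
    (h61 : 2 * (2 * (L * cstar) + 8 * α₄) ^ 2 + 20 * d * α₀ * (2 * (L * cstar) + 8 * α₄)
      + 2 * C₂ * (2 * (L * cstar) + 8 * α₄) ^ 2 ≤ α₀ + α₁)
    (Ω : ℕ → Set (Site d)) (hΩ : ∀ j, Ω (j + 1) ⊆ Ω j) (Λs : ℕ → ℕ → Set (Site d)) (Λb : ℕ → ℕ → Set (Site d × Fin d))
    -- PRINT's box law (edition γ): the locality box of a level-`j` datum bond lies in `Ω_{j−1}` ((1.31); level 0: `Ω₀`)
    (hbox : ∀ m, m ≤ k → ∀ j, j ≤ m → ∀ c ∈ Λb m j, ∀ x, InBox (loK L j c.1) (bondHiK L j c.1 c.2) x → x ∈ Ω (j - 1))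
    (hclass : ∀ m, m ≤ k → ∀ j, j ≤ m → ∀ c ∈ Λb m j,
      (c.1 ∈ Λs m j ∧ c.1 + e c.2 ∈ Λs m j) ∨
      (∃ j', j = j' + 1 ∧ (∀ x, (L : ℤ) • c.1 ≤ x → x ≤ (L : ℤ) • c.1 + blockTop L → x ∈ Λs m j') ∧ c.1 + e c.2 ∈ Λs m j) ∨
      (∃ j', j = j' + 1 ∧ c.1 ∈ Λs m j ∧ (∀ x, (L : ℤ) • (c.1 + e c.2) ≤ x → x ≤ (L : ℤ) • (c.1 + e c.2) + blockTop L → x ∈ Λs m j')))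
    (h33 : InAk L k η α₀ Ω U₀) (h34 : InAk L k η α₀ Ω (mulCfg U' U₀))
    (hAx : ∀ m, m ≤ k → InAx L m (Λs m) U₀ (mulCfg U' U₀))
    -- the tower law AT EVERY TRUNCATION `m ≤ k`: the `j`-block of every site of `Λs m j` lies in `Ω_j` ((1.5)–(1.6) p. 77; `IdxB8Sub.tower_all`)
    (htw : ∀ m, m ≤ k → ∀ j, j ≤ m → ∀ y ∈ Λs m j, ∀ x, InBox (tlo L y j) (thi L y j) x → x ∈ Ω j)
    -- (1.35) in PRINT's class (p. 77 «at least one end-point of b belongs to Ω»): every level-`j` bond with an end-BLOCK inside `Ω_j` (edition γ′, dag-n05-w2)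
    (h135 : ∀ j, j ≤ k → ∀ (z : Site d) (μ : Fin d),
      ((∀ x, InBox (tlo L z j) (thi L z j) x → x ∈ Ω j) ∨ (∀ x, InBox (tlo L (z + e μ) j) (thi L (z + e μ) j) x → x ∈ Ω j)) →
      ‖(avgIter L (mulCfg U' U₀) j z μ : 𝔸) - (avgIter L U₀ j z μ : 𝔸)‖ ≤ α₁)
    (h66 : ∀ b ∈ {b : Site d × Fin d | SideTouches (Ω 0) b.1 b.2}, ‖((U' b.1 b.2 : 𝔸ˣ) : 𝔸) - 1‖ ≤ a)
    (Lan : ℕ → (Site d → Fin d → 𝔸ˣ) → Prop)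
    (hP5base : ∃ (v : Site d → 𝔸ˣ) (lam : Site d → 𝔸), (∀ x, v x ∈ unitaryUnits 𝔸) ∧ (∀ x, x ∉ Ω 0 → v x = 1) ∧
        (∀ j, j ≤ 1 → ∀ b ∈ {b : Site d × Fin d | SideTouches (Ω j) b.1 b.2}, (v b.1 : 𝔸) = ((gaugeExp lam b.1 : 𝔸ˣ) : 𝔸) ∧
          (v (b.1 + e b.2) : 𝔸) = ((gaugeExp lam (b.1 + e b.2) : 𝔸ˣ) : 𝔸)) ∧
        (∀ j, j ≤ 1 → ∀ b ∈ {b : Site d × Fin d | SideTouches (Ω j) b.1 b.2},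
          ‖lam b.1‖ ≤ α₄ ∧ ((L : ℝ) ^ j * η) * ‖covDerivFwd η U₀ b.2 lam b.1‖ ≤ α₄) ∧
        Lan 1 (mgauge U₀ v⁻¹ U') ∧ Restr129 L 1 (Λs 1) U₀ ((1 : Site d → 𝔸ˣ) * v))
    (hP5 : ∀ m, 1 ≤ m → m < k → ∀ (u₁ : Site d → 𝔸ˣ) (U₁ : Site d → Fin d → 𝔸ˣ) (A : Site d → Fin d → 𝔸),
      (∀ x, u₁ x ∈ unitaryUnits 𝔸) → (∀ x, x ∉ Ω 0 → u₁ x = 1) → mgauge U₀ u₁ U₁ = U' → Restr129 L m (Λs m) U₀ u₁ →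
      Lan m U₁ →
      (∀ j, j ≤ m → ∀ b ∈ {b : Site d × Fin d | SideTouches (Ω j) b.1 b.2},
        U₁ b.1 b.2 = cfgExp η A b.1 b.2 ∧ IsSelfAdjoint (A b.1 b.2) ∧ ‖A b.1 b.2‖ ≤ cstar * ((L : ℝ) ^ j * η)⁻¹) →
      ∃ (v : Site d → 𝔸ˣ) (lam : Site d → 𝔸), (∀ x, v x ∈ unitaryUnits 𝔸) ∧ (∀ x, x ∉ Ω 0 → v x = 1) ∧
        (∀ j, j ≤ m + 1 → ∀ b ∈ {b : Site d × Fin d | SideTouches (Ω j) b.1 b.2}, (v b.1 : 𝔸) = ((gaugeExp lam b.1 : 𝔸ˣ) : 𝔸) ∧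
          (v (b.1 + e b.2) : 𝔸) = ((gaugeExp lam (b.1 + e b.2) : 𝔸ˣ) : 𝔸)) ∧
        (∀ j, j ≤ m + 1 → ∀ b ∈ {b : Site d × Fin d | SideTouches (Ω j) b.1 b.2},
          ‖lam b.1‖ ≤ α₄ ∧ ((L : ℝ) ^ j * η) * ‖covDerivFwd η U₀ b.2 lam b.1‖ ≤ α₄) ∧
        Lan (m + 1) (mgauge U₀ v⁻¹ U₁) ∧ Restr129 L (m + 1) (Λs (m + 1)) U₀ (u₁ * v))
    (H59src : ∀ m, 1 ≤ m → m ≤ k → ∀ (u : Site d → 𝔸ˣ) (W : Site d → Fin d → 𝔸ˣ) (A' : Site d → Fin d → 𝔸),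
      (∀ x, u x ∈ unitaryUnits 𝔸) → mgauge U₀ u W = U' → Restr129 L m (Λs m) U₀ u → Lan m W →
      (∀ y τ, IsSelfAdjoint (A' y τ)) →
      (∀ j, j ≤ m → ∀ y τ, SideTouches (Ω j) y τ →
        W y τ = cfgExp η A' y τ ∧ ‖A' y τ‖ ≤ (2 * (L * cstar) + 8 * α₄) * ((L : ℝ) ^ j * η)⁻¹) →
      (∀ y τ, (∀ j, j ≤ m → ¬ SideTouches (Ω j) y τ) → A' y τ = 0) →
      msup L m η (-(1 : ℝ)) (fun j (b : Site d × Fin d) => SideTouches (Ω j) b.1 b.2) (fun b => A' b.1 b.2)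
          ≤ B₀ * (bondNorm L m η (-(3 : ℝ)) Ω (fun x μ => Jcur η U₀ A' μ x)
            + wsup 1 (fun p : {p : ℕ × (Site d × Fin d) // p.1 ≤ m ∧ p.2 ∈ Λb m p.1} =>
                linCovIter L U₀ (iEta η A') p.1.1 p.1.2.1 p.1.2.2)) + Ta ∧
        msup L m η (-(2 : ℝ)) (fun j (t : Fin d × Fin d × Site d) => SideTouches (Ω j) t.2.2 t.2.1)
            (fun t => covDerivFwd η U₀ t.1 (fun z => A' z t.2.1) t.2.2)
          ≤ B₀ * (bondNorm L m η (-(3 : ℝ)) Ω (fun x μ => Jcur η U₀ A' μ x)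
            + wsup 1 (fun p : {p : ℕ × (Site d × Fin d) // p.1 ≤ m ∧ p.2 ∈ Λb m p.1} =>
                linCovIter L U₀ (iEta η A') p.1.1 p.1.2.1 p.1.2.2)) + Tg) :
    ∀ m, m ≤ k → ∃ u : Site d → 𝔸ˣ, (∀ x, u x ∈ unitaryUnits 𝔸) ∧ (∀ x, x ∉ Ω 0 → u x = 1) ∧ Restr129 L m (Λs m) U₀ u ∧
      ∃ W : Site d → Fin d → 𝔸ˣ, mgauge U₀ u W = U' ∧ (1 ≤ m → Lan m W) ∧
        ∃ A : Site d → Fin d → 𝔸, ∀ j, j ≤ m → ∀ b ∈ {b : Site d × Fin d | SideTouches (Ω j) b.1 b.2},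
          W b.1 b.2 = cfgExp η A b.1 b.2 ∧ IsSelfAdjoint (A b.1 b.2) ∧ ‖A b.1 b.2‖ ≤ cstar * ((L : ℝ) ^ j * η)⁻¹ := by
  have hL1 : 1 ≤ L := le_trans (by norm_num) hL
  have hcstar : 0 ≤ cstar := le_trans (by positivity) hc
  have hα₂ : 0 ≤ 2 * (L * cstar) + 8 * α₄ := by positivity
  have hE : ∀ j, {b : Site d × Fin d | SideTouches (Ω (j + 1)) b.1 b.2} ⊆ {b : Site d × Fin d | SideTouches (Ω j) b.1 b.2} :=
    fun j b hb => B8Eq140Level.sideTouches_mono (hΩ j) hb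
  exact thm4_exists_all_levels_supp hL1 hη (Ω 0) hU₀ hU' hcstar hα₄ hs₁ hs₂ ha ha2
    (fun j => {b : Site d × Fin d | SideTouches (Ω j) b.1 b.2}) hE h66 Λs Lan
    hP5base hP5
    (hP3_gaugeFixed_of_b9_src_γ hd2 hη hL k hU₀ hU' hα₀ hα₁.le hα₄ hB₀ hTa hTg hc hα3 hα4 h16 hd5 hsmall hc₃ hside h50 hC₂ h61 Ω Λs Λb hbox
      h33 h34 Lan
      (fun m hm1 hmk => B8Eq142KLevelLocalGammaPrime.H42_of_inAx_γ' hd2 hη hL k hU₀ hα₀ hα₁ hα₂ hα3 hα4 h16γ hsmall hc₃ hsmall₁ Ω hΩ Λs Λb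
        hbox hclass h33 h34 hAx h135 Lan m hm1 hmk (htw m hmk))
      H59src)

end Composition

#print axioms thm4_exists_all_levels_supp_src_γ'

end Literature.MathematicalPhysics.QuantumFieldTheory.Balaban1983to89.B8Prop3GaugeFixedKLevelSrcGammaPrime

end
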